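import Literature.NumberTheory.NumberFields.UnramifiedElementaryCentralModP
import HarnessLib

/-!
# The unramified elementary-abelian `p`-quotient of `Gal(E/M)` made CENTRAL over `k`: its order divides the order of the
# `Gal(M/k)`-COINVARIANTS of `Cl(M)/p` (quantitative companion of `UnramifiedElementaryCentralModP`; door L12 of the cell `bsd-potss`; proved)

`Proofs`-style file (theorems only: no definition, no named fact, no `sorry`) in topic `NumberTheory/NumberFields`
(namespace `Literature.NumberTheory.NumberFields`), written by the prover seat `bsd-potss-k9-c4` g26 (cell `bsd-potss`; serves the
`μ`-roads of the record lane of stmt-BirchSwinnertonDyer-19197; closes nothing).  Sibling of `UnramifiedElementaryCentralModP`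
(conjA-anchor g21): there, «every `σ ∈ Gal(M/k)` trivial on `Cl(M)/p`» gives «`G/N·G^p` is centralised by `Gal(E/k)`»; here, with NO
hypothesis, the subgroup `N·G^p·⁅Gal(E/k), G⁆` (the smallest one whose quotient is unramified, elementary abelian AND central over `k`)
has index DIVIDING `[Cl(M) : Cl(M)^p · ⟨σc·c⁻¹ : σ ∈ Gal(M/k), c⟩]`, the order of the `Gal(M/k)`-coinvariants of `Cl(M)/p`.

THE THEOREM (`index_sup_pow_sup_comap_commutator_dvd`).  `k ⊆ M ⊆ E` number fields, `E/k` and `M/k` finite Galois, `E/M` unramified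
at the infinite places; `G = Gal(E/M)`, `ρ : G → Gal(E/k)` restriction of scalars; `N ≤ G` containing `G'` and every inertia group
`I(𝔔)`; `G^p = ⟨σ^p⟩`; `D = ρ⁻¹⁅Gal(E/k), ρ(G)⁆`.  Then `[G : N·G^p·D] ∣ [Cl(𝓞 M) : Cl^p·⟨σc·c⁻¹⟩]`.

PROOF.  `C = N·G^p·D` contains `G'`; its fixed field `F = E^C` is abelian of exponent `p` over `M`, unramified at all places (inertia
`≤ N ≤ C`, tree `isUnramifiedAt_under_iff_inertia_le'`), normal over `k` (`ρ(C) ⊇ ⁅Gal(E/k), ρ(G)⁆` is normal in `Gal(E/k)` because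
`ρ(G)` is, `M/k` being normal), and `Gal(F/M)` is CENTRAL in `Gal(F/k)` (a commutator `⁅τ̃, ã⁆` of lifts lies in `ρ(D) ⊆ ρ(C)` and acts
trivially on `F`).  A copy of `F` lies in `H = hilbertClassField M` (maximality, `le_hilbertClassField`), so `Gal(F/M)` is the quotient
of `Gal(H/M) ≅ Cl(𝓞 M)` (Artin, `artinEquiv`) by `S = artinEquiv⁻¹ Gal(H/F)`, and `[F : M] = [Cl : S]`.  Now `Cl^p ≤ S` (exponent `p`)
and `σc·c⁻¹ ∈ S`: the Artin isomorphism is EQUIVARIANT (`artinEquiv_mulEquiv_intAut_apply`, Neukirch IV §6): `(H/M, σc) = τ̃ (H/M, c) τ̃⁻¹`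
for a lift `τ̃ ∈ Gal(H/k)` of `σ`, and restricted to `F` the conjugate equals `(H/M, c)|_F` by centrality.  Hence `[G : C] = [F : M] =
[Cl : S] ∣ [Cl : Cl^p·⟨σc·c⁻¹⟩]`.

USE (cell `bsd-potss`, door L12 «coinvariant small-rank criterion», `IwasawaTheory.Fukuda1994Thm1RankLayerCoinvariant`): with `k = K_{n+i}`,
`M = K_{n+j}`, `E = H_p(K_{n+t})` (Fukuda's package) the left side is `[G_j : N_j·P_j·⁅G_i, G_j⁆] = #(A/((φ^{p^i} - 1)A + ν_j Y₀ + pA))`,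
the finite-level shadow of `dim X̄/T^{p^i}X̄`, which is `≥ p^i` as soon as `X̄ = X/pX` has a free `𝔽_p⟦T⟧`-summand (`μ > 0`).

References: [NeukirchANT1999] J. Neukirch, *Algebraic Number Theory* (1999), Ch. IV §6 (functoriality of the norm residue symbol), Ch. VI §7
Thm. (7.1), §6 Prop. (6.9); [Cox2013] D. A. Cox, *Primes of the form x² + ny²*, 2nd ed., §5.C Cor. 5.24, §8.A Thm. 8.10; [Washington1997]
L. Washington, *Introduction to Cyclotomic Fields*, 2nd ed., §13.3 Lemma 13.15, Prop. 13.22 (the `Γ`-module `X/(ν_n Y + pX)`); [Lang1990]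
S. Lang, *Cyclotomic Fields I and II*, Ch. 13 §4 (genus theory in `ℤ_p`-extensions).
-/

set_option autoImplicit false

noncomputable section

open scoped NumberField commutatorElement
open NumberField IsDedekindDomain Field IntermediateField

namespace Literature.NumberTheory.NumberFields

/-! ## §1 Galois plumbing: commutators of lifts inside `Gal(L/L^N)` make `Gal(L^N/F')` central over `k'` -/

section Central

variable {k' F' L : Type*} [Field k'] [Field F'] [Field L] [Algebra k' F'] [Algebra k' L] [Algebra F' L]
  [IsScalarTower k' F' L] [FiniteDimensional F' L] [IsGalois F' L] [Normal k' L]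

/-- `L/F'` finite Galois, `L/k'` normal, `N ⊴ Gal(L/F')`, `E = L^N` normal over `k'`; `ρ` = restriction of scalars
`Gal(L/F') → Aut_{k'}(L)`.  If `⁅τ, ρ a⁆ ∈ ρ(N)` for all `τ ∈ Aut_{k'}(L)`, `a ∈ Gal(L/F')`, then `Gal(E/F')` is central in `Gal(E/k')`:
conjugation by any `k'`-automorphism of `E` fixes every `F'`-automorphism of `E`. [folklore] -/
private theorem central_of_commutator_mem_map (N : Subgroup (L ≃ₐ[F'] L)) [N.Normal]
    (E : IntermediateField F' L) (hE : E = IntermediateField.fixedField N) [Normal k' E]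
    (ρ : (L ≃ₐ[F'] L) →* (L ≃ₐ[k'] L)) (hρ : ∀ a y, ρ a y = a y)
    (hmem : ∀ (τ : L ≃ₐ[k'] L) (a : L ≃ₐ[F'] L), ⁅τ, ρ a⁆ ∈ N.map ρ)
    (τ : E ≃ₐ[k'] E) (b b' : E ≃ₐ[F'] E) (hb' : ∀ y, b' y = τ (b (τ.symm y))) : b' = b := by
  classical
  haveI : Normal F' E := by rw [hE]; exact (IsGalois.of_fixedField_normal_subgroup N).to_normal
  haveI : IsScalarTower k' E L := IsScalarTower.of_algebraMap_eq fun x => by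
    rw [IsScalarTower.algebraMap_apply k' F' L x, IsScalarTower.algebraMap_apply k' F' E x,
      ← IsScalarTower.algebraMap_apply F' E L]
  -- lift `τ` to `L` over `k'` and `b` to `L` over `F'`
  set τL : L ≃ₐ[k'] L := τ.liftNormal L with hτL
  set a : L ≃ₐ[F'] L := b.liftNormal L with ha
  have hτL_res : ∀ x : E, τL (algebraMap E L x) = algebraMap E L (τ x) := fun x => AlgEquiv.liftNormal_commutes τ L x
  have ha_res : ∀ x : E, a (algebraMap E L x) = algebraMap E L (b x) := fun x => AlgEquiv.liftNormal_commutes b L x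
  have hτL_symm_res : ∀ x : E, τL.symm (algebraMap E L x) = algebraMap E L (τ.symm x) := by
    intro x
    apply τL.injective
    rw [AlgEquiv.apply_symm_apply, hτL_res, AlgEquiv.apply_symm_apply]
  -- the commutator `⁅τL, ρ a⁆` lies in `ρ(N)`, hence fixes `E` pointwise
  obtain ⟨n, hn, hnc⟩ := hmem τL a
  have hN : N = E.fixingSubgroup := by rw [hE, IntermediateField.fixingSubgroup_fixedField]
  have hfix : ∀ y : E, ⁅τL, ρ a⁆ (algebraMap E L y) = algebraMap E L y := by
    intro y
    rw [← hnc, hρ]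
    have hn' : n ∈ E.fixingSubgroup := hN ▸ hn
    exact (IntermediateField.mem_fixingSubgroup_iff _ _).mp hn' _ y.2
  -- evaluate at `algebraMap E L (b y)`
  apply AlgEquiv.ext
  intro y
  apply (algebraMap E L).injective
  have h1 := hfix (b y)
  have h3 : (ρ a)⁻¹ (algebraMap E L (b y)) = algebraMap E L y := by
    rw [← map_inv, hρ]
    change a.symm (algebraMap E L (b y)) = _
    apply a.injective
    rw [AlgEquiv.apply_symm_apply, ha_res]
  rw [commutatorElement_def, AlgEquiv.mul_apply, AlgEquiv.mul_apply, AlgEquiv.mul_apply, h3, hρ,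
    show τL⁻¹ (algebraMap E L y) = τL.symm (algebraMap E L y) from rfl, hτL_symm_res, ha_res, hτL_res] at h1
  rw [hb', h1]

end Central

/-! ## §2 The theorem -/

section Main

variable (k M E : Type) [Field k] [Field M] [NumberField M] [Field E] [NumberField E]
  [Algebra k M] [Algebra k E] [Algebra M E] [IsScalarTower k M E]
  [IsGalois k E] [IsGalois k M] [FiniteDimensional M E] [IsGalois M E] [IsUnramifiedAtInfinitePlaces M E]

omit [NumberField M] [NumberField E] [IsGalois k E] [FiniteDimensional M E] [IsGalois M E] [IsUnramifiedAtInfinitePlaces M E] in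
/-- For `τ ∈ Aut_k(E)` and `a ∈ Gal(E/M)` (`M/k` normal) the conjugate `τ a τ⁻¹` is `M`-linear. [folklore] -/
private theorem exists_conj_gal (τ : E ≃ₐ[k] E) (a : E ≃ₐ[M] E) :
    ∃ a' : E ≃ₐ[M] E, ∀ y, a' y = τ (a (τ.symm y)) := by
  have hτF : ∀ z : M, τ (algebraMap M E z) = algebraMap M E ((τ.restrictNormal M) z) := fun z =>
    (AlgEquiv.restrictNormal_commutes τ M z).symm
  have hτF_symm : ∀ z : M, τ.symm (algebraMap M E z) = algebraMap M E ((τ.restrictNormal M).symm z) := by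
    intro z; apply τ.injective; rw [AlgEquiv.apply_symm_apply, hτF, AlgEquiv.apply_symm_apply]
  refine ⟨AlgEquiv.ofRingEquiv (f := τ.symm.toRingEquiv.trans (a.toRingEquiv.trans τ.toRingEquiv)) fun z => ?_,
    fun y => rfl⟩
  change τ (a (τ.symm (algebraMap M E z))) = algebraMap M E z
  rw [hτF_symm, AlgEquiv.commutes, hτF, AlgEquiv.apply_symm_apply]

set_option maxHeartbeats 1600000 in
set_option synthInstance.maxHeartbeats 200000 in
/-- **The unramified elementary-abelian central `p`-quotient is a quotient of the coinvariants.**  `k ⊆ M ⊆ E` number fields with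
`E/k` and `M/k` finite Galois and `E/M` unramified at the infinite places; `G = Gal(E/M)`, `ρ : G → Gal(E/k)` restriction of scalars,
`N ≤ G` a subgroup containing `G'` and the inertia group `I(𝔔)` of every maximal ideal `𝔔 ⊂ 𝓞 E`, `G^p = ⟨σ^p⟩`.  Then
**`[G : N·G^p·ρ⁻¹⁅Gal(E/k), ρ(G)⁆]` divides `[Cl(𝓞 M) : Cl^p·⟨σc·c⁻¹ : σ ∈ Gal(M/k)⟩]`**, the order of the `Gal(M/k)`-coinvariants
of `Cl(𝓞 M)/p` (class field theory: the fixed field of `N·G^p·ρ⁻¹⁅·,·⁆` is abelian of exponent `p` over `M`, unramified, with Galois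
group central in its Galois group over `k`, hence an EQUIVARIANT quotient of `Cl(𝓞 M)` — Artin reciprocity is functorial in
automorphisms, Neukirch IV §6 — on which `Gal(M/k)` acts trivially).
[cite: NeukirchANT1999, Ch. IV §6 and Ch. VI §7 Thm. (7.1), §6 Prop. (6.9)] [cite: Cox2013, §5.C Cor. 5.24 and §8.A Thm. 8.10]
[cite: Washington1997, §13.3 Lemma 13.15 and Prop. 13.22] -/
theorem index_sup_pow_sup_comap_commutator_dvd (p : ℕ) (N : Subgroup (E ≃ₐ[M] E))
    (hcomm : ⁅(⊤ : Subgroup (E ≃ₐ[M] E)), ⊤⁆ ≤ N)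
    (hIN : ∀ (Q : Ideal (𝓞 E)) [Q.IsMaximal], Q.inertia (E ≃ₐ[M] E) ≤ N)
    (ρ : (E ≃ₐ[M] E) →* (E ≃ₐ[k] E)) (hρ : ∀ a y, ρ a y = a y) :
    ((N ⊔ Subgroup.closure (Set.range fun σ : E ≃ₐ[M] E => σ ^ p)) ⊔
        (⁅(⊤ : Subgroup (E ≃ₐ[k] E)), ρ.range⁆).comap ρ).index ∣
      ((powMonoidHom p : ClassGroup (𝓞 M) →* ClassGroup (𝓞 M)).range ⊔
        Subgroup.closure {x | ∃ (σ : M ≃ₐ[k] M) (c : ClassGroup (𝓞 M)),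
          x = ClassGroup.mulEquiv (AmbiguousClass.intAut σ) c * c⁻¹}).index := by
  classical
  -- ### the subgroup `C = N·G^p·ρ⁻¹⁅⊤, ρ(G)⁆` and its fixed field `F`
  set D : Subgroup (E ≃ₐ[M] E) := (⁅(⊤ : Subgroup (E ≃ₐ[k] E)), ρ.range⁆).comap ρ with hD
  set C : Subgroup (E ≃ₐ[M] E) := (N ⊔ Subgroup.closure (Set.range fun σ : E ≃ₐ[M] E => σ ^ p)) ⊔ D with hC
  have hcommC : ⁅(⊤ : Subgroup (E ≃ₐ[M] E)), ⊤⁆ ≤ C := hcomm.trans (le_sup_left.trans le_sup_left)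
  have hIC : ∀ (Q : Ideal (𝓞 E)) [Q.IsMaximal], Q.inertia (E ≃ₐ[M] E) ≤ C := fun Q _ =>
    (hIN Q).trans (le_sup_left.trans le_sup_left)
  haveI hCn : C.Normal := ⟨fun m hm g => by
    have h2 := Subgroup.commutator_mem_commutator (Subgroup.mem_top g) (Subgroup.mem_top m)
    rw [commutatorElement_def] at h2
    have h1 : g * m * g⁻¹ = g * m * g⁻¹ * m⁻¹ * m := by group
    rw [h1]
    exact mul_mem (hcommC h2) hm⟩
  set F : IntermediateField M E := IntermediateField.fixedField C with hF
  haveI : IsGalois M F := IsGalois.of_fixedField_normal_subgroup C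
  have hFdeg : Module.finrank M F = C.index := by
    have h1 := Module.finrank_mul_finrank M F E
    rw [hF, IntermediateField.finrank_fixedField_eq_card C] at h1
    have h2 : C.index * Nat.card C = Nat.card (E ≃ₐ[M] E) := C.index_mul_card
    rw [IsGalois.card_aut_eq_finrank] at h2
    rw [hF]
    exact Nat.eq_of_mul_eq_mul_right Nat.card_pos (h1.trans h2.symm)
  -- `Gal(F/M) ≅ G/C` is commutative and killed by `p`
  haveI : IsAbelianGalois M F := by
    refine { is_comm := ⟨fun x y => ?_⟩ }
    obtain ⟨x', rfl⟩ := (IsGalois.normalAutEquivQuotient C).surjective x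
    obtain ⟨y', rfl⟩ := (IsGalois.normalAutEquivQuotient C).surjective y
    rw [← map_mul, ← map_mul]
    congr 1
    have hc : IsMulCommutative ((E ≃ₐ[M] E) ⧸ C) := by
      rw [Subgroup.Normal.quotient_commutative_iff_commutator_le, commutator_def]
      exact hcommC
    exact hc.is_comm.comm x' y'
  have hexp : ∀ x : F ≃ₐ[M] F, x ^ p = 1 := by
    intro x
    obtain ⟨x', rfl⟩ := (IsGalois.normalAutEquivQuotient C).surjective x
    obtain ⟨σ, rfl⟩ := QuotientGroup.mk_surjective x'
    rw [← map_pow, ← QuotientGroup.mk_pow, (QuotientGroup.eq_one_iff _).mpr, map_one]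
    exact Subgroup.mem_sup_left (Subgroup.mem_sup_right (Subgroup.subset_closure ⟨σ, rfl⟩))
  haveI : IsUnramifiedAtInfinitePlaces M F :=
    isUnramifiedAtInfinitePlaces_of_algHom (IsScalarTower.toAlgHom M F E)
  have hunrF : ∀ v : HeightOneSpectrum (𝓞 M), Algebra.IsUnramifiedIn (𝓞 F) v.asIdeal := by
    intro v q hq hqv
    haveI := hq
    have hq0 : q ≠ ⊥ := by
      intro h0
      apply v.ne_bot
      rw [hqv.over, h0, Ideal.under_def, Ideal.comap_bot_of_injective _
        (FaithfulSMul.algebraMap_injective (𝓞 M) (𝓞 F))]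
    haveI : q.IsMaximal := hq.isMaximal hq0
    obtain ⟨Q, hQmax, hQq⟩ := Ideal.exists_maximal_ideal_liesOver_of_isIntegral (S := 𝓞 E) q
    haveI := hQmax
    have hq' : q = Q.under (𝓞 F) := hQq.over
    subst hq'
    rw [isUnramifiedAt_under_iff_inertia_le' F Q, hF, IntermediateField.fixingSubgroup_fixedField]
    exact hIC Q
  -- ### `ρ(G)` is normalised by `Gal(E/k)` (`M/k` normal), so `ρ(C) ⊇ ⁅⊤, ρ(G)⁆` is normal and `F/k` is normal
  have hcomm_le_range : ⁅(⊤ : Subgroup (E ≃ₐ[k] E)), ρ.range⁆ ≤ ρ.range := by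
    rw [Subgroup.commutator_le]
    rintro τ - b ⟨a, rfl⟩
    obtain ⟨a', ha'⟩ := exists_conj_gal k M E τ a
    have hconj : τ * ρ a * τ⁻¹ = ρ a' := by
      apply AlgEquiv.ext; intro y
      rw [AlgEquiv.mul_apply, AlgEquiv.mul_apply, hρ, hρ, ha']; rfl
    rw [commutatorElement_def, hconj, ← map_inv, ← map_mul]
    exact ⟨a' * a⁻¹, rfl⟩
  have hDmap : D.map ρ = ⁅(⊤ : Subgroup (E ≃ₐ[k] E)), ρ.range⁆ := by
    rw [hD, Subgroup.map_comap_eq, inf_eq_right.mpr hcomm_le_range]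
  haveI : (C.map ρ).Normal := ⟨fun x hx τ => by
    have hx' : x ∈ ρ.range := by
      obtain ⟨c, -, rfl⟩ := hx
      exact ⟨c, rfl⟩
    have h1 : τ * x * τ⁻¹ = ⁅τ, x⁆ * x := by rw [commutatorElement_def]; group
    rw [h1]
    refine mul_mem ?_ hx
    have h2 : ⁅τ, x⁆ ∈ ⁅(⊤ : Subgroup (E ≃ₐ[k] E)), ρ.range⁆ :=
      Subgroup.commutator_mem_commutator (Subgroup.mem_top τ) hx'
    rw [← hDmap] at h2
    exact Subgroup.map_mono (le_sup_right : D ≤ C) h2⟩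
  have hFk : F.restrictScalars k = IntermediateField.fixedField (C.map ρ) := by
    ext x
    rw [IntermediateField.mem_restrictScalars, hF, IntermediateField.mem_fixedField_iff,
      IntermediateField.mem_fixedField_iff]
    constructor
    · rintro h _ ⟨n, hn, rfl⟩
      rw [hρ]
      exact h n hn
    · intro h n hn
      rw [← hρ]
      exact h (ρ n) ⟨n, hn, rfl⟩
  haveI : Normal k F := by
    have h1 : IsGalois k (IntermediateField.fixedField (C.map ρ)) := IsGalois.of_fixedField_normal_subgroup (C.map ρ)
    have h2 : Normal k (F.restrictScalars k) := by rw [hFk]; exact h1.to_normal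
    exact h2
  -- ### `Gal(F/M)` is central in `Gal(F/k)`
  have hcentF : ∀ (τ : F ≃ₐ[k] F) (b b' : F ≃ₐ[M] F), (∀ y, b' y = τ (b (τ.symm y))) → b' = b := by
    refine central_of_commutator_mem_map (k' := k) (F' := M) (L := E) C F hF ρ hρ (fun τ a => ?_)
    have h2 : ⁅τ, ρ a⁆ ∈ ⁅(⊤ : Subgroup (E ≃ₐ[k] E)), ρ.range⁆ :=
      Subgroup.commutator_mem_commutator (Subgroup.mem_top τ) ⟨a, rfl⟩
    rw [← hDmap] at h2
    exact Subgroup.map_mono (le_sup_right : D ≤ C) h2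
  -- ### a copy of `F` inside the Hilbert class field `H` of `M`; `H` as an `F`-algebra
  haveI : NumberField F := NumberField.of_module_finite M F
  haveI : Algebra.IsAlgebraic M F := Algebra.IsAlgebraic.of_finite M F
  let ι₀ : F →ₐ[M] AlgebraicClosure M := IsAlgClosed.lift
  let F' : IntermediateField M (AlgebraicClosure M) := ι₀.fieldRange
  let e : F ≃ₐ[M] F' := AlgEquiv.ofInjectiveField ι₀
  haveI : FiniteDimensional M F' := LinearEquiv.finiteDimensional e.toLinearEquiv
  haveI : IsAbelianGalois M F' := IsAbelianGalois.of_algHom e.symm.toAlgHom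
  haveI : NumberField F' := NumberField.of_module_finite M F'
  haveI : IsUnramifiedAtInfinitePlaces M F' := isUnramifiedAtInfinitePlaces_of_algHom e.symm.toAlgHom
  have hunr' := forall_isUnramifiedIn_of_algHom e.symm.toAlgHom hunrF
  have hle : F' ≤ hilbertClassField M := hilbertClassField.le_hilbertClassField M F' hunr'
  let ι : F →ₐ[M] hilbertClassField M := (IntermediateField.inclusion hle).comp (e : F →ₐ[M] F')
  letI : Algebra F (hilbertClassField M) := ι.toRingHom.toAlgebra
  haveI : IsScalarTower M F (hilbertClassField M) := IsScalarTower.of_algebraMap_eq fun x => (ι.commutes x).symm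
  haveI : IsScalarTower k M (hilbertClassField M) :=
    IsScalarTower.of_algebraMap_eq fun x => Subtype.ext (IsScalarTower.algebraMap_apply k M (AlgebraicClosure M) x)
  haveI : IsScalarTower k F (hilbertClassField M) := IsScalarTower.of_algebraMap_eq fun x => by
    rw [IsScalarTower.algebraMap_apply k M (hilbertClassField M) x,
      IsScalarTower.algebraMap_apply M F (hilbertClassField M) (algebraMap k M x), ← IsScalarTower.algebraMap_apply k M F x]
  haveI : IsGalois k (hilbertClassField M) := hilbertClassField.isGalois_of_isGalois M
  haveI : Normal M F := inferInstance
  -- ### `S = artinEquiv⁻¹ Gal(H/F)`: `[Cl : S] = [F : M] = [G : C]`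
  set π : (hilbertClassField M ≃ₐ[M] hilbertClassField M) →* (F ≃ₐ[M] F) := AlgEquiv.restrictNormalHom F with hπ
  have hπ_apply : ∀ (a : hilbertClassField M ≃ₐ[M] hilbertClassField M) (y : F),
      algebraMap F (hilbertClassField M) (π a y) = a (algebraMap F (hilbertClassField M) y) := fun a y =>
    AlgEquiv.restrictNormal_commutes a F y
  have hπ_surj : Function.Surjective π := AlgEquiv.restrictNormalHom_surjective (hilbertClassField M)
  set S : Subgroup (ClassGroup (𝓞 M)) := π.ker.comap (hilbertClassField.artinEquiv M).toMonoidHom with hS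
  have hSindex : S.index = C.index := by
    rw [hS, Subgroup.index_comap_of_surjective _ (hilbertClassField.artinEquiv M).surjective, Subgroup.index_ker,
      MonoidHom.range_eq_top.mpr hπ_surj, Subgroup.card_top, IsGalois.card_aut_eq_finrank, hFdeg]
  have hmemS : ∀ c : ClassGroup (𝓞 M), c ∈ S ↔ π (hilbertClassField.artinEquiv M c) = 1 := fun c => by
    rw [hS, Subgroup.mem_comap, MonoidHom.mem_ker]; rfl
  -- ### `Cl^p ≤ S`
  have hpow : (powMonoidHom p : ClassGroup (𝓞 M) →* ClassGroup (𝓞 M)).range ≤ S := by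
    rintro _ ⟨c, rfl⟩
    rw [hmemS, powMonoidHom_apply, map_pow, map_pow, hexp]
  -- ### the coinvariant classes `σc·c⁻¹` lie in `S` (equivariant Artin + centrality)
  have hcoinv : Subgroup.closure {x | ∃ (σ : M ≃ₐ[k] M) (c : ClassGroup (𝓞 M)),
      x = ClassGroup.mulEquiv (AmbiguousClass.intAut σ) c * c⁻¹} ≤ S := by
    rw [Subgroup.closure_le]
    rintro _ ⟨σ, c, rfl⟩
    rw [SetLike.mem_coe, hmemS, map_mul, map_inv, map_mul, map_inv, mul_inv_eq_one]
    -- a lift `τH ∈ Gal(H/k)` of `σ`, the conjugate `a'` of `a = (H/M, c)`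
    set τH : hilbertClassField M ≃ₐ[k] hilbertClassField M := σ.liftNormal (hilbertClassField M) with hτH
    have hτ : ∀ x : M, τH (algebraMap M (hilbertClassField M) x) = algebraMap M (hilbertClassField M) (σ x) :=
      fun x => AlgEquiv.liftNormal_commutes σ (hilbertClassField M) x
    set a := hilbertClassField.artinEquiv M c with ha
    obtain ⟨a', ha'⟩ := hilbertClassField.exists_algEquiv_conj M τH σ hτ a
    have key : hilbertClassField.artinEquiv M (ClassGroup.mulEquiv (AmbiguousClass.intAut σ) c) = a' :=
      AlgEquiv.ext fun y => (hilbertClassField.artinEquiv_mulEquiv_intAut_apply M τH σ hτ c y).trans (ha' y).symm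
    rw [key]
    -- restrict to `F`: `π a' = τF (π a) τF⁻¹ = π a` by centrality
    set τF : F ≃ₐ[k] F := τH.restrictNormal F with hτF
    have hτF_res : ∀ y : F, algebraMap F (hilbertClassField M) (τF y) = τH (algebraMap F (hilbertClassField M) y) :=
      fun y => AlgEquiv.restrictNormal_commutes τH F y
    have hτF_symm_res : ∀ y : F, algebraMap F (hilbertClassField M) (τF.symm y) = τH.symm (algebraMap F (hilbertClassField M) y) := by
      intro y; apply τH.injective
      rw [AlgEquiv.apply_symm_apply, ← hτF_res, AlgEquiv.apply_symm_apply]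
    refine hcentF τF (π a) (π a') fun y => ?_
    apply (algebraMap F (hilbertClassField M)).injective
    rw [hπ_apply, ha', hτF_res, hπ_apply, hτF_symm_res]
  -- ### conclusion
  rw [← hSindex]
  exact Subgroup.index_dvd_of_le (sup_le hpow hcoinv)

end Main

end Literature.NumberTheory.NumberFields

end
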